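import Summits.Ventures.WeilGRH.FlatWindowArchCostSeries
import HarnessLib

/-!
# rh-explicit (venture WeilGRH): THE OSCILLATORY PART OF THE ARCHIMEDEAN COST OF A MODULATED WINDOW
  DECAYS IN THE HEIGHT — `|∫₀^∞ ρ_κ(t) min(t,2a) cos(τt) dt| ≤ 2/|τ| + 2/τ²`

Cell `rh-explicit`, WEIL TRACK (structure seat weil-3, gen11).  RH/GRH-free real analysis; no measure, no
zeros.  In the window form of the flat window modulated to height `τ`, `u_{a,τ} = e^{−iτx}χ_0`
(`ZetaWindowAtoms.weilWindowForm_modulated_chi_zero`, `TwistedModulatedFlatTest`), the archimedean place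
contributes

  `−K_κ + ∫₀^∞ ρ_κ(t) (2(1 − cos τt) + cos(τt) min(t,2a)/a) dt`,   `ρ_κ(t) = e^{(1/2−κ)t}/(2 sinh t) = Σ_m e^{−(2m+½+κ)t}`.

The first part is the digamma weight exactly (`TwistedModulationCost.integral_weilArchDensity_modulationCost`:
`∫ρ₀·2(1 − cos τt) = Re ψ(¼+iτ/2) − Re ψ(¼)`); the second, `a⁻¹∫ρ_κ cos(τt) min(t,2a)`, was so far charged its
trivial bound `5/a` (`FlatWindowAtoms.integral_modulationCost_le`), which is what makes the explicit window
budgets of `ZetaWindowAtoms` / `WindowBudgetGoldstonGonek` lose `5/a ≈ 6` at the frontier rung.  It is in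
fact OSCILLATORY and small — this file; the resulting phase-blind archimedean budget is
`ModulationCostPhaseBlind.lean`.

* `integral_cexp_neg_mul_min` (complex Laplace transform of the triangle profile):
  `∫₀^∞ e^{−rt} min(t,2a) dt = (1 − e^{−2ar})/r²` for `Re r > 0` (FTC on `(0,2a]`, exponential tail);
* `integral_exp_neg_mul_min_mul_cos`, **`abs_integral_exp_neg_mul_min_mul_cos_le`**: at each node `l > 0`,
  `|∫₀^∞ e^{−lt} min(t,2a) cos(τt) dt| = |Re[(1 − e^{−2a(l+iτ)})/(l+iτ)²]| ≤ 2/(l² + τ²)`;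
* **`abs_integral_weilArchDensityPar_mul_min_mul_cos_le`** (finite exponential split of `ρ_κ`
  (`WeilArchDensityMoments`, `FlatWindowArchCostSeries`), every `M`):
  `|∫₀^∞ ρ_κ(t) min(t,2a) cos(τt) dt| ≤ Σ_{m<M} 2/((2m+½+κ)² + τ²) + 1/L² + 1/(2L)`, `L = 2M+½+κ`;
* `oscillatoryArchBound_le_coarse`, `…_le_coarse`: `≤ 2M/τ² + 1/(2M)` (`τ ≠ 0`, `M ≥ 1`);
* **`abs_integral_weilArchDensityPar_mul_min_mul_cos_le_inv`** (`M = ⌈|τ|/2⌉`): **`≤ 2/|τ| + 2/τ²`** for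
  `|τ| ≥ 2` — the oscillatory archimedean increment decays like `1/|τ|`, uniformly in the window and the
  parity.

No definitions, no named facts; RH-free.
-/

set_option autoImplicit false

noncomputable section

open Complex Filter Set MeasureTheory
open scoped Real Topology

namespace Summit.Ventures.WeilGRH

open Literature.NumberTheory.LFunctions

variable {a : ℝ}

/-! ## The complex Laplace transform of the triangle profile `min(t, 2a)` -/

/-- `|min(t, 2a)| ≤ t` for `t > 0`, `a ≥ 0`. -/
private theorem abs_min_le_self {t : ℝ} (ht : 0 < t) (ha : 0 ≤ a) : |min t (2 * a)| ≤ t := by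
  rcases le_or_gt t (2 * a) with h | h
  · rw [min_eq_left h, abs_of_pos ht]
  · rw [min_eq_right h.le, abs_le]; constructor <;> linarith

/-- `t ↦ e^{−rt} min(t, 2a)` is integrable on `(0, ∞)` for complex `r` with `Re r > 0` (dominated by `t e^{−(Re r)t}`). -/
theorem integrableOn_cexp_neg_mul_min {r : ℂ} (hr : 0 < r.re) (ha : 0 ≤ a) :
    IntegrableOn (fun t : ℝ ↦ cexp (-(r * t)) * ((min t (2 * a) : ℝ) : ℂ)) (Ioi 0) := by
  refine (integrableOn_mul_exp_neg_mul_Ioi hr).mono' ?_ ?_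
  · exact ((Complex.continuous_exp.comp ((continuous_const.mul Complex.continuous_ofReal).neg)).mul
      (Complex.continuous_ofReal.comp (continuous_id.min continuous_const))).aestronglyMeasurable
  · refine (ae_restrict_iff' measurableSet_Ioi).2 (Eventually.of_forall fun t (ht : 0 < t) ↦ ?_)
    rw [norm_mul, Complex.norm_exp, Complex.norm_real, Real.norm_eq_abs]
    have hre : (-(r * (t : ℂ))).re = -(r.re * t) := by simp
    rw [hre]
    calc Real.exp (-(r.re * t)) * |min t (2 * a)| ≤ Real.exp (-(r.re * t)) * t :=
          mul_le_mul_of_nonneg_left (abs_min_le_self ht ha) (Real.exp_pos _).le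
      _ = t * Real.exp (-(r.re * t)) := mul_comm _ _

/-- **`∫₀^∞ e^{−rt} min(t, 2a) dt = (1 − e^{−2ar})/r²`** for complex `r` with `Re r > 0` (`a ≥ 0`):
`∫₀^{2a} t e^{−rt} dt = [−(rt+1)e^{−rt}/r²]₀^{2a}` plus `2a∫_{2a}^∞ e^{−rt} dt = 2a e^{−2ar}/r`. -/
theorem integral_cexp_neg_mul_min {r : ℂ} (hr : 0 < r.re) (ha : 0 ≤ a) :
    ∫ t in Ioi (0 : ℝ), cexp (-(r * t)) * ((min t (2 * a) : ℝ) : ℂ) =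
      (1 - cexp (-(r * (2 * a : ℝ)))) / r ^ 2 := by
  have hr0 : r ≠ 0 := fun h ↦ by rw [h, Complex.zero_re] at hr; exact lt_irrefl _ hr
  have hf := integrableOn_cexp_neg_mul_min hr ha
  have h2a : (0 : ℝ) ≤ 2 * a := by linarith
  have hdisj : Disjoint (Ioc (0 : ℝ) (2 * a)) (Ioi (2 * a)) :=
    Set.disjoint_left.2 fun x hx hx' ↦ (not_lt.2 hx.2) hx'
  rw [← Ioc_union_Ioi_eq_Ioi h2a, setIntegral_union hdisj measurableSet_Ioi (hf.mono_set Ioc_subset_Ioi_self)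
    (hf.mono_set (Ioi_subset_Ioi h2a))]
  -- the bulk `∫_{(0,2a]} t e^{−rt}` by the fundamental theorem of calculus
  have hbulk : ∫ t in Ioc 0 (2 * a), cexp (-(r * t)) * ((min t (2 * a) : ℝ) : ℂ) =
      -((r * (2 * a : ℝ) + 1) * cexp (-(r * (2 * a : ℝ)))) / r ^ 2 - -((r * (0 : ℝ) + 1) * cexp (-(r * (0 : ℝ)))) / r ^ 2 := by
    rw [setIntegral_congr_fun measurableSet_Ioc (fun t ht ↦ by rw [min_eq_left ht.2] :
        ∀ t ∈ Ioc (0 : ℝ) (2 * a), cexp (-(r * t)) * ((min t (2 * a) : ℝ) : ℂ) = cexp (-(r * t)) * (t : ℂ)),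
      ← intervalIntegral.integral_of_le h2a]
    have hderiv : ∀ t : ℝ, HasDerivAt (fun s : ℝ ↦ -((r * (s : ℂ) + 1) * cexp (-(r * (s : ℂ)))) / r ^ 2)
        (cexp (-(r * t)) * (t : ℂ)) t := by
      intro t
      have h1 : HasDerivAt (fun s : ℝ ↦ r * (s : ℂ)) r t := by
        simpa using ((hasDerivAt_id (t : ℂ)).const_mul r).comp_ofReal
      have h2 : HasDerivAt (fun s : ℝ ↦ cexp (-(r * (s : ℂ)))) (cexp (-(r * t)) * (-r)) t := h1.neg.cexp
      have h3 : HasDerivAt (fun s : ℝ ↦ r * (s : ℂ) + 1) r t := h1.add_const 1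
      have h4 := ((h3.mul h2).neg).div_const (r ^ 2)
      refine h4.congr_deriv ?_
      rw [div_eq_iff (pow_ne_zero 2 hr0)]
      ring
    exact intervalIntegral.integral_eq_sub_of_hasDerivAt (fun t _ ↦ hderiv t)
      ((by fun_prop : Continuous fun t : ℝ ↦ cexp (-(r * (t : ℂ))) * (t : ℂ)).intervalIntegrable _ _)
  -- the tail `2a ∫_{2a}^∞ e^{−rt}`
  have htail : ∫ t in Ioi (2 * a), cexp (-(r * t)) * ((min t (2 * a) : ℝ) : ℂ) =
      ((2 * a : ℝ) : ℂ) * (cexp (-(r * (2 * a : ℝ))) / r) := by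
    rw [setIntegral_congr_fun measurableSet_Ioi (fun t (ht : 2 * a < t) ↦ by rw [min_eq_right ht.le, mul_comm] :
        ∀ t ∈ Ioi (2 * a), cexp (-(r * t)) * ((min t (2 * a) : ℝ) : ℂ) = ((2 * a : ℝ) : ℂ) * cexp (-(r * t))),
      integral_const_mul]
    have hre : (-r).re < 0 := by rw [Complex.neg_re, neg_lt_zero]; exact hr
    have h := integral_exp_mul_complex_Ioi hre (2 * a)
    simp only [neg_mul] at h
    rw [h]
    congr 1
    field_simp
  rw [hbulk, htail]
  simp only [Complex.ofReal_zero, mul_zero, neg_zero, Complex.exp_zero, zero_add, mul_one]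
  field_simp
  ring

/-- **The node integral against a cosine, in closed form**:
`∫₀^∞ e^{−lt} min(t,2a) cos(τt) dt = Re[(1 − e^{−2a(l+iτ)})/(l+iτ)²]` (`l > 0`, `a ≥ 0`). -/
theorem integral_exp_neg_mul_min_mul_cos {l : ℝ} (hl : 0 < l) (ha : 0 ≤ a) (τ : ℝ) :
    ∫ t in Ioi (0 : ℝ), Real.exp (-(l * t)) * min t (2 * a) * Real.cos (τ * t) =
      ((1 - cexp (-(((l : ℂ) + τ * I) * (2 * a : ℝ)))) / ((l : ℂ) + τ * I) ^ 2).re := by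
  set r : ℂ := (l : ℂ) + τ * I with hr
  have hr' : 0 < r.re := by simp [hr, hl]
  have hint := integrableOn_cexp_neg_mul_min hr' ha
  have hpt : ∀ t : ℝ, (cexp (-(r * t)) * ((min t (2 * a) : ℝ) : ℂ)).re =
      Real.exp (-(l * t)) * min t (2 * a) * Real.cos (τ * t) := by
    intro t
    rw [Complex.re_mul_ofReal, Complex.exp_re]
    have h1 : (-(r * (t : ℂ))).re = -(l * t) := by simp [hr]
    have h2 : (-(r * (t : ℂ))).im = -(τ * t) := by simp [hr]
    rw [h1, h2, Real.cos_neg]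
    ring
  rw [← integral_cexp_neg_mul_min hr' ha, ← integral_congr_ae (Eventually.of_forall fun t ↦ hpt t)]
  change ∫ t in Ioi (0 : ℝ), RCLike.re (cexp (-(r * t)) * ((min t (2 * a) : ℝ) : ℂ)) = _
  rw [integral_re hint]
  rfl

/-- **THE NODE INTEGRALS DECAY IN THE HEIGHT**: `|∫₀^∞ e^{−lt} min(t,2a) cos(τt) dt| ≤ 2/(l² + τ²)`
(`l > 0`, `a ≥ 0`, every `τ`; `|1 − e^{−2a(l+iτ)}| ≤ 2`, `|l + iτ|² = l² + τ²`). -/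
theorem abs_integral_exp_neg_mul_min_mul_cos_le {l : ℝ} (hl : 0 < l) (ha : 0 ≤ a) (τ : ℝ) :
    |∫ t in Ioi (0 : ℝ), Real.exp (-(l * t)) * min t (2 * a) * Real.cos (τ * t)| ≤ 2 / (l ^ 2 + τ ^ 2) := by
  rw [integral_exp_neg_mul_min_mul_cos hl ha]
  set r : ℂ := (l : ℂ) + τ * I with hr
  have hre : r.re = l := by simp [hr]
  have him : r.im = τ := by simp [hr]
  have hnorm : ‖r‖ ^ 2 = l ^ 2 + τ ^ 2 := by
    rw [Complex.sq_norm, Complex.normSq_apply, hre, him]; ring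
  have hpos : 0 < l ^ 2 + τ ^ 2 := by positivity
  refine (Complex.abs_re_le_norm _).trans ?_
  rw [norm_div, norm_pow, hnorm]
  refine div_le_div_of_nonneg_right ?_ hpos.le
  have hexp : ‖cexp (-(r * ((2 * a : ℝ) : ℂ)))‖ ≤ 1 := by
    rw [Complex.norm_exp]
    have : (-(r * ((2 * a : ℝ) : ℂ))).re = -(l * (2 * a)) := by simp [hr]
    rw [this]
    exact Real.exp_le_one_iff.2 (by nlinarith)
  calc ‖1 - cexp (-(r * ((2 * a : ℝ) : ℂ)))‖ ≤ ‖(1 : ℂ)‖ + ‖cexp (-(r * ((2 * a : ℝ) : ℂ)))‖ := norm_sub_le _ _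
    _ ≤ 1 + 1 := by rw [norm_one]; exact add_le_add le_rfl hexp
    _ = 2 := by norm_num

/-- `t ↦ e^{−lt} min(t,2a) cos(τt)` is integrable on `(0, ∞)` (`l > 0`, `a ≥ 0`). -/
theorem integrableOn_exp_neg_mul_min_mul_cos {l : ℝ} (hl : 0 < l) (ha : 0 ≤ a) (τ : ℝ) :
    IntegrableOn (fun t : ℝ ↦ Real.exp (-(l * t)) * min t (2 * a) * Real.cos (τ * t)) (Ioi 0) :=
  (integrableOn_exp_neg_mul_min hl ha).mul_bdd (c := 1)
    (by fun_prop : Continuous fun t : ℝ ↦ Real.cos (τ * t)).aestronglyMeasurable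
    (Eventually.of_forall fun t ↦ by rw [Real.norm_eq_abs]; exact Real.abs_cos_le_one _)

/-! ## The oscillatory part of the archimedean cost of the modulated flat window -/

/-- `t ↦ ρ_κ(t) min(t,2a) cos(τt)` is integrable on `(0, ∞)` (`a ≥ 0`). -/
theorem integrableOn_weilArchDensityPar_mul_min_mul_cos (κ : ℕ) (ha : 0 ≤ a) (τ : ℝ) :
    IntegrableOn (fun t : ℝ ↦ weilArchDensityPar κ t * min t (2 * a) * Real.cos (τ * t)) (Ioi 0) :=
  (integrableOn_weilArchDensityPar_mul_min κ ha).mul_bdd (c := 1)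
    (by fun_prop : Continuous fun t : ℝ ↦ Real.cos (τ * t)).aestronglyMeasurable
    (Eventually.of_forall fun t ↦ by rw [Real.norm_eq_abs]; exact Real.abs_cos_le_one _)

/-- **THE OSCILLATORY ARCHIMEDEAN INCREMENT IS SMALL** (finite exponential split, every `M`): for `a ≥ 0`, every
parity `κ`, every `τ` and every `M`,

  `|∫₀^∞ ρ_κ(t) min(t,2a) cos(τt) dt| ≤ Σ_{m<M} 2/((2m+½+κ)² + τ²) + 1/L² + 1/(2L)`,  `L = 2M + ½ + κ`

(`ρ_κ = Σ_{m<M} e^{−(2m+½+κ)t} + e^{−κt}rem_M`, node integrals `≤ 2/(l² + τ²)`, remainder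
`e^{−κt}rem_M(t)min(t,2a) ≤ t e^{−Lt} + e^{−Lt}/2`). -/
theorem abs_integral_weilArchDensityPar_mul_min_mul_cos_le (κ : ℕ) (ha : 0 ≤ a) (τ : ℝ) (M : ℕ) :
    |∫ t in Ioi (0 : ℝ), weilArchDensityPar κ t * min t (2 * a) * Real.cos (τ * t)| ≤
      (∑ m ∈ Finset.range M, 2 / ((2 * (m : ℝ) + 1 / 2 + κ) ^ 2 + τ ^ 2)) +
        (1 / (2 * (M : ℝ) + 1 / 2 + κ) ^ 2 + 1 / (2 * (2 * (M : ℝ) + 1 / 2 + κ))) := by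
  have hl : ∀ m : ℕ, (0 : ℝ) < 2 * m + 1 / 2 + κ := fun m ↦ by positivity
  set L : ℝ := 2 * M + 1 / 2 + κ with hL
  have hL0 : 0 < L := hl M
  have hterm : ∀ m ∈ Finset.range M, IntegrableOn (fun t : ℝ ↦
      Real.exp (-((2 * m + 1 / 2 + κ) * t)) * min t (2 * a) * Real.cos (τ * t)) (Ioi 0) :=
    fun m _ ↦ integrableOn_exp_neg_mul_min_mul_cos (hl m) ha τ
  have hS : IntegrableOn (fun t : ℝ ↦ ∑ m ∈ Finset.range M,
      Real.exp (-((2 * m + 1 / 2 + κ) * t)) * min t (2 * a) * Real.cos (τ * t)) (Ioi 0) :=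
    integrable_finsetSum _ hterm
  have hR1 := integrableOn_mul_exp_neg_mul_Ioi hL0
  have hR2 := integrableOn_exp_neg_mul_div_two hL0
  have hf := integrableOn_weilArchDensityPar_mul_min_mul_cos κ ha τ
  -- the pointwise split on `(0, ∞)`
  have hsplit : ∀ t ∈ Ioi (0 : ℝ), weilArchDensityPar κ t * min t (2 * a) * Real.cos (τ * t) =
      (∑ m ∈ Finset.range M, Real.exp (-((2 * m + 1 / 2 + κ) * t)) * min t (2 * a) * Real.cos (τ * t)) +
        Real.exp (-((κ : ℝ) * t)) * weilArchDensityRem M t * min t (2 * a) * Real.cos (τ * t) := by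
    intro t ht
    rw [weilArchDensityPar_mul_min_eq_sum_add ht κ M a, add_mul, Finset.sum_mul]
  have hRint : IntegrableOn (fun t ↦
      Real.exp (-((κ : ℝ) * t)) * weilArchDensityRem M t * min t (2 * a) * Real.cos (τ * t)) (Ioi 0) := by
    refine (hf.sub hS).congr_fun (fun t ht ↦ ?_) measurableSet_Ioi
    simp only [Pi.sub_apply]
    rw [hsplit t ht]
    ring
  have hI : ∫ t in Ioi (0 : ℝ), weilArchDensityPar κ t * min t (2 * a) * Real.cos (τ * t) =
      (∑ m ∈ Finset.range M, ∫ t in Ioi (0 : ℝ),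
          Real.exp (-((2 * m + 1 / 2 + κ) * t)) * min t (2 * a) * Real.cos (τ * t)) +
        ∫ t in Ioi (0 : ℝ), Real.exp (-((κ : ℝ) * t)) * weilArchDensityRem M t * min t (2 * a) * Real.cos (τ * t) := by
    rw [setIntegral_congr_fun measurableSet_Ioi hsplit, integral_add hS hRint, integral_finsetSum _ hterm]
  rw [hI]
  -- the remainder integral
  have hRbound : |∫ t in Ioi (0 : ℝ),
      Real.exp (-((κ : ℝ) * t)) * weilArchDensityRem M t * min t (2 * a) * Real.cos (τ * t)| ≤
      1 / L ^ 2 + 1 / (2 * L) := by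
    rw [← integral_mul_exp_neg_mul_Ioi hL0, ← integral_exp_neg_mul_div_two_Ioi hL0, ← integral_add hR1 hR2]
    refine abs_integral_le_integral_abs.trans ?_
    refine setIntegral_mono_on hRint.abs (hR1.add hR2) measurableSet_Ioi fun t (ht : 0 < t) ↦ ?_
    have hrem := weilArchDensityRem_le ht M
    have hrem0 := weilArchDensityRem_nonneg ht M
    have hm0 : 0 ≤ min t (2 * a) := le_min ht.le (by linarith)
    have hmt : min t (2 * a) ≤ t := min_le_left _ _
    have hexp : Real.exp (-((κ : ℝ) * t)) * Real.exp (-((2 * M + 1 / 2) * t)) = Real.exp (-(L * t)) := by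
      rw [← Real.exp_add, hL]; congr 1; ring
    have hX0 : 0 ≤ Real.exp (-((κ : ℝ) * t)) * weilArchDensityRem M t * min t (2 * a) :=
      mul_nonneg (mul_nonneg (Real.exp_pos _).le hrem0) hm0
    have key : Real.exp (-((κ : ℝ) * t)) * weilArchDensityRem M t * min t (2 * a) ≤
        t * Real.exp (-(L * t)) + Real.exp (-(L * t)) / 2 := by
      calc Real.exp (-((κ : ℝ) * t)) * weilArchDensityRem M t * min t (2 * a)
          ≤ Real.exp (-((κ : ℝ) * t)) * (Real.exp (-((2 * M + 1 / 2) * t)) * (1 + 1 / (2 * t))) * t := by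
            refine mul_le_mul (mul_le_mul_of_nonneg_left hrem (Real.exp_pos _).le) hmt hm0 ?_
            exact mul_nonneg (Real.exp_pos _).le (hrem0.trans hrem)
        _ = Real.exp (-(L * t)) * (t + 1 / 2) := by
            rw [← hexp]; field_simp
        _ = t * Real.exp (-(L * t)) + Real.exp (-(L * t)) / 2 := by ring
    rw [abs_mul, abs_of_nonneg hX0]
    calc Real.exp (-((κ : ℝ) * t)) * weilArchDensityRem M t * min t (2 * a) * |Real.cos (τ * t)|
        ≤ Real.exp (-((κ : ℝ) * t)) * weilArchDensityRem M t * min t (2 * a) * 1 :=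
          mul_le_mul_of_nonneg_left (Real.abs_cos_le_one _) hX0
      _ ≤ _ := by rw [mul_one]; exact key
  -- the node integrals
  have hTbound : |∑ m ∈ Finset.range M, ∫ t in Ioi (0 : ℝ),
      Real.exp (-((2 * m + 1 / 2 + κ) * t)) * min t (2 * a) * Real.cos (τ * t)| ≤
      ∑ m ∈ Finset.range M, 2 / ((2 * (m : ℝ) + 1 / 2 + κ) ^ 2 + τ ^ 2) :=
    (Finset.abs_sum_le_sum_abs _ _).trans
      (Finset.sum_le_sum fun m _ ↦ abs_integral_exp_neg_mul_min_mul_cos_le (hl m) ha τ)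
  exact (abs_add_le _ _).trans (add_le_add hTbound hRbound)

/-- The coarse form of the bound: for `τ ≠ 0` and `M ≥ 1`,
`Σ_{m<M} 2/((2m+½+κ)² + τ²) + 1/L² + 1/(2L) ≤ 2M/τ² + 1/(2M)`. -/
theorem oscillatoryArchBound_le_coarse (κ : ℕ) {τ : ℝ} (hτ : τ ≠ 0) {M : ℕ} (hM : 1 ≤ M) :
    (∑ m ∈ Finset.range M, 2 / ((2 * (m : ℝ) + 1 / 2 + κ) ^ 2 + τ ^ 2)) +
        (1 / (2 * (M : ℝ) + 1 / 2 + κ) ^ 2 + 1 / (2 * (2 * (M : ℝ) + 1 / 2 + κ))) ≤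
      2 * M / τ ^ 2 + 1 / (2 * M) := by
  have hτ2 : 0 < τ ^ 2 := by positivity
  have hM' : (1 : ℝ) ≤ M := by exact_mod_cast hM
  have hκ : (0 : ℝ) ≤ κ := κ.cast_nonneg
  have h1 : ∑ m ∈ Finset.range M, 2 / ((2 * (m : ℝ) + 1 / 2 + κ) ^ 2 + τ ^ 2) ≤
      ∑ m ∈ Finset.range M, (2 / τ ^ 2 : ℝ) :=
    Finset.sum_le_sum fun m _ ↦ div_le_div_of_nonneg_left (by norm_num) hτ2
      (by nlinarith [sq_nonneg (2 * (m : ℝ) + 1 / 2 + κ)])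
  rw [Finset.sum_const, Finset.card_range, nsmul_eq_mul] at h1
  set L : ℝ := 2 * M + 1 / 2 + κ with hL
  have hL0 : 0 < L := by positivity
  have hLM : 2 * (M : ℝ) + 1 / 2 ≤ L := by rw [hL]; linarith
  have h3 : (M : ℝ) * (2 + L) ≤ L ^ 2 := by
    nlinarith [mul_nonneg (sub_nonneg.2 hLM) (by positivity : (0 : ℝ) ≤ 3 * M + 1),
      sq_nonneg (L - (2 * M + 1 / 2)), sq_nonneg ((M : ℝ) - 1 / 8)]
  have hLne : L ≠ 0 := hL0.ne'
  have h2 : 1 / L ^ 2 + 1 / (2 * L) ≤ 1 / (2 * M) := by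
    rw [show 1 / L ^ 2 + 1 / (2 * L) = (2 + L) / (2 * L ^ 2) by field_simp,
      div_le_div_iff₀ (by positivity) (by positivity)]
    nlinarith [h3]
  calc _ ≤ (M : ℝ) * (2 / τ ^ 2) + 1 / (2 * M) := add_le_add h1 h2
    _ = 2 * M / τ ^ 2 + 1 / (2 * M) := by ring

/-- **Coarse form**: `|∫₀^∞ ρ_κ(t) min(t,2a) cos(τt) dt| ≤ 2M/τ² + 1/(2M)` for `τ ≠ 0`, every `M ≥ 1`. -/
theorem abs_integral_weilArchDensityPar_mul_min_mul_cos_le_coarse (κ : ℕ) (ha : 0 ≤ a) {τ : ℝ}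
    (hτ : τ ≠ 0) {M : ℕ} (hM : 1 ≤ M) :
    |∫ t in Ioi (0 : ℝ), weilArchDensityPar κ t * min t (2 * a) * Real.cos (τ * t)| ≤
      2 * M / τ ^ 2 + 1 / (2 * M) :=
  (abs_integral_weilArchDensityPar_mul_min_mul_cos_le κ ha τ M).trans (oscillatoryArchBound_le_coarse κ hτ hM)

/-- **`|∫₀^∞ ρ_κ(t) min(t,2a) cos(τt) dt| ≤ 2/|τ| + 2/τ²`** for `|τ| ≥ 2` (`M = ⌈|τ|/2⌉`): the oscillatory
archimedean increment of the window modulated to height `τ` decays like `1/|τ|`. -/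
theorem abs_integral_weilArchDensityPar_mul_min_mul_cos_le_inv (κ : ℕ) (ha : 0 ≤ a) {τ : ℝ}
    (hτ : 2 ≤ |τ|) :
    |∫ t in Ioi (0 : ℝ), weilArchDensityPar κ t * min t (2 * a) * Real.cos (τ * t)| ≤
      2 / |τ| + 2 / τ ^ 2 := by
  set u : ℝ := |τ| with hu
  have hu0 : 0 < u := by linarith
  have hτ0 : τ ≠ 0 := abs_pos.1 hu0
  set M : ℕ := ⌈u / 2⌉₊ with hM
  have hMge : u / 2 ≤ (M : ℝ) := Nat.le_ceil _
  have hMlt : (M : ℝ) < u / 2 + 1 := Nat.ceil_lt_add_one (by positivity)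
  have hM1 : 1 ≤ M := by
    have : (1 : ℝ) ≤ (M : ℝ) := by linarith
    exact_mod_cast this
  refine (abs_integral_weilArchDensityPar_mul_min_mul_cos_le_coarse κ ha hτ0 hM1).trans ?_
  have hsq : τ ^ 2 = u ^ 2 := (sq_abs τ).symm
  rw [hsq]
  have hA : 2 * (M : ℝ) / u ^ 2 ≤ 1 / u + 2 / u ^ 2 := by
    rw [show 1 / u + 2 / u ^ 2 = (u + 2) / u ^ 2 by field_simp]
    exact div_le_div_of_nonneg_right (by linarith) (by positivity)
  have hB : 1 / (2 * (M : ℝ)) ≤ 1 / u :=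
    one_div_le_one_div_of_le hu0 (by linarith)
  calc 2 * (M : ℝ) / u ^ 2 + 1 / (2 * M) ≤ (1 / u + 2 / u ^ 2) + 1 / u := add_le_add hA hB
    _ = 2 / u + 2 / u ^ 2 := by ring

end Summit.Ventures.WeilGRH

end
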